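import Summits.QuantumFields.QCD.Theses.NestedDissectionSea
import Literature.MathematicalPhysics.QuantumFieldTheory.QCDPhaseQuenchedReweighting
import Literature.MathematicalPhysics.QuantumLattice.OverlapLocality

/-!
# Crux `NegativeCellsDilute` (stmt-QuantumFields-13900), negative side — line `mass-wegner-cell-index`,
# stub `stub_pinnedStripLaw`: NO TOLERANCE-ROBUST STRIP LAW

Support file of the deep-refute seat (refuter-drefute-stmt-QuantumFields-13900-g2-0, 2026-08-16),
companion of `CellPositivity.lean` / `PinWindow.lean` / `UniformPinFalse.lean`. The open stub of the
picked line, `stub_pinnedStripLaw` = (a⁺) WINDOWED STRIP LAW ∧ (b) PARITY PIN, bounds the strip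
statistic `η⁻¹ Σ_f ∫_{μ' ∈ [m_f, η − edge(s)]} P(near_η(·, μ′)) dμ′` at a tolerance quantified
`∀ᶠ k, ∀ S, ∃ η > 0, …`. Proved here (sorry-free, standard axioms):
* `near_of_large_eta` — for `|m + 4| + 4 < η` EVERY gauge field has an `η`-near-kernel vector in
  every non-empty Dirichlet cell of every torus (unit vector at one index; column bound
  `Σ_p |D_{pq}|² ≤ ‖D_W‖² ≤ (|m + 4| + 4)²` from the tree's HJL operator-norm bound);
* `le_stripStatistic` — hence the strip statistic (verbatim body) is `≥ N_f/4` once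
  `|μ' + 4| + 4 < η` on the quarter-strips `[m_f, m_f + η/4]` (`P(sure) = 1`, normaliser `> 0`);
* `exists_good_mass`, `weight_integral_pos` — above any threshold some valence mass has a bare
  trajectory missing, at every step and on every odd torus, the finitely many real roots of the
  free-field Wilson determinant (countable ⇒ null), so the phase-quenched normaliser is positive;
* `not_stripLaw_forall_eta` — the NATURAL STRENGTHENING of (a⁺) with a universal tolerance
  (`∃ η > 0` ↦ `∀ η > 0`; scaling side conditions and pin dropped, so the stub with that one token
  changed is refuted a fortiori) is FALSE for every regularisation: the placement of `∃ η` after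
  `(k, S)` and the freedom to tune it DOWN are load-bearing; any admissible tolerance is
  `< 2 max_f |m_f(k)| + 20` (physically, below the valence gap `≍ a_k m_min/Z_m(k)`); the
  "η-robust, measured at fixed η" reading of the line card has no true formalisation of this shape.
-/


noncomputable section

namespace Summit.QuantumFields.QCD.Theorems.NegativeCellsDiluteStripLawForallEtaFalse

open scoped BigOperators ENNReal Classical Matrix Topology
open MeasureTheory Filter
open Literature.MathematicalPhysics.QuantumLattice Literature.MathematicalPhysics.QuantumFieldTheory
  Literature.Probability.LatticeModels

variable {N : ℕ} [NeZero N]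

/-! ### Every gauge field is near-kernel at a large tolerance -/

section Column

open scoped Matrix.Norms.L2Operator

/-- **Column bound** `Σ_p ‖D_W(U, m, 1)_{pq}‖² ≤ (|m + 4| + 4)²` for every gauge field, torus and
column: the unit vector at `q` through the tree's `ℓ²` operator-norm bound
`‖D_W(U, m, 1)‖ ≤ |m + 4| + 4` (`l2_opNorm_wilsonDirac_le`, HJL (2.14)). -/
theorem sum_norm_sq_wilsonDirac_col_le (U : GaugeConfig 4 N SU3) (m : ℝ)
    (q : TorusSite 4 N × Fin 3 × Fin 4) :
    ∑ p, ‖wilsonDirac (fundamentalRep (Fin 3)) U m 1 p q‖ ^ 2 ≤ (|m + 4| + 4) ^ 2 := by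
  have h := sum_norm_sq_mulVec_le (wilsonDirac (fundamentalRep (Fin 3)) U m 1)
    (Pi.single q (1 : ℂ))
  have hn := l2_opNorm_wilsonDirac_le (fundamentalRep (Fin 3)) fundamentalRep_mem_unitaryGroup U m
  have h1 : ∑ i, ‖(Pi.single q (1 : ℂ) : TorusSite 4 N × Fin 3 × Fin 4 → ℂ) i‖ ^ 2 = 1 := by
    rw [Finset.sum_eq_single q]
    · simp
    · intro p _ hp; simp [hp]
    · intro h; exact absurd (Finset.mem_univ q) h
  rw [Matrix.mulVec_single_one, h1, mul_one] at h
  exact h.trans (pow_le_pow_left₀ (norm_nonneg _) hn 2)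

end Column

/-- **Every gauge field is `η`-near-kernel at a large tolerance.** If the box `(x, s)` contains an
index `p₁` and `|m + 4| + 4 < η`, the unit vector at `p₁` is an `η`-near-kernel vector of the
Dirichlet cell `wilsonCell U m x s` for EVERY gauge field `U` (on every torus). -/
theorem near_of_large_eta (U : GaugeConfig 4 N SU3) (m : ℝ) (x : TorusSite 4 N)
    (s : Fin 4 → ℕ) (p₁ : {p // wilsonBox x s p}) {η : ℝ} (hη : |m + 4| + 4 < η) :
    ∃ v : {p // wilsonBox x s p} → ℂ, v ≠ 0 ∧
      ∑ p, ‖(wilsonCell U m x s).mulVec v p‖ ^ 2 < η ^ 2 * ∑ p, ‖v p‖ ^ 2 := by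
  refine ⟨Pi.single p₁ 1, fun h => by simpa using congr_fun h p₁, ?_⟩
  · have hv : ∑ p, ‖(Pi.single p₁ (1 : ℂ) : {p // wilsonBox x s p} → ℂ) p‖ ^ 2 = 1 := by
      rw [Finset.sum_eq_single p₁]
      · simp
      · intro p _ hp; simp [hp]
      · intro h; exact absurd (Finset.mem_univ p₁) h
    rw [hv, mul_one]
    have hmv : ∀ p, (wilsonCell U m x s).mulVec (Pi.single p₁ 1) p =
        wilsonDirac (fundamentalRep (Fin 3)) U m 1 p.1 p₁.1 := fun p => by
      rw [Matrix.mulVec_single_one]; rfl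
    simp_rw [hmv]
    calc ∑ p : {p // wilsonBox x s p}, ‖wilsonDirac (fundamentalRep (Fin 3)) U m 1 p.1 p₁.1‖ ^ 2
        = ∑ p ∈ Finset.univ.filter (wilsonBox x s),
            ‖wilsonDirac (fundamentalRep (Fin 3)) U m 1 p p₁.1‖ ^ 2 :=
          (Finset.sum_subtype (Finset.univ.filter (wilsonBox x s)) (by simp)
            (fun p => ‖wilsonDirac (fundamentalRep (Fin 3)) U m 1 p p₁.1‖ ^ 2)).symm
      _ ≤ ∑ p, ‖wilsonDirac (fundamentalRep (Fin 3)) U m 1 p p₁.1‖ ^ 2 :=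
          Finset.sum_le_univ_sum_of_nonneg fun p => by positivity
      _ ≤ (|m + 4| + 4) ^ 2 := sum_norm_sq_wilsonDirac_col_le U m p₁.1
      _ < η ^ 2 := pow_lt_pow_left₀ hη (by positivity) two_ne_zero

/-! ### Phase-quenched probabilities: `P ≤ 1`, and `P = 1` for a sure event -/

/-- The phase-quenched weight `∏_f |det D_W(U, m_f, 1)|` is `|det D(U)|` for the flavour-diagonal
matrix `diracMatrix` (tree `norm_det_diracMatrix`, reversed). -/
theorem weight_eq_norm_det {Nf : ℕ} (mq : Fin Nf → ℝ) (U : GaugeConfig 4 N SU3) :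
    ∏ f, ‖fermionDet (wilsonDirac (fundamentalRep (Fin 3)) U (mq f) 1)‖ = ‖(diracMatrix U mq).det‖ :=
  (norm_det_diracMatrix U mq).symm

/-- A phase-quenched probability is at most `1` whenever the normaliser is positive (the
numerator is the junk `0` if it is not integrable; any decidability instance). -/
theorem pqProb_le_one (β : ℝ) {Nf : ℕ} (mq : Fin Nf → ℝ) (E : GaugeConfig 4 N SU3 → Prop)
    {_dE : DecidablePred E}
    (hZ : 0 < ∫ U, ∏ f, ‖fermionDet (wilsonDirac (fundamentalRep (Fin 3)) U (mq f) 1)‖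
      ∂(wilsonMeasure (d := 4) (L := N) (fundamentalRep (Fin 3)) β)) :
    (∫ U, (if E U then (1 : ℝ) else 0) * ∏ f, ‖fermionDet (wilsonDirac (fundamentalRep (Fin 3)) U (mq f) 1)‖
        ∂(wilsonMeasure (d := 4) (L := N) (fundamentalRep (Fin 3)) β)) /
      (∫ U, ∏ f, ‖fermionDet (wilsonDirac (fundamentalRep (Fin 3)) U (mq f) 1)‖
        ∂(wilsonMeasure (d := 4) (L := N) (fundamentalRep (Fin 3)) β)) ≤ 1 := by
  rw [div_le_one hZ]
  have h0 : ∀ U : GaugeConfig 4 N SU3,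
      0 ≤ ∏ f, ‖fermionDet (wilsonDirac (fundamentalRep (Fin 3)) U (mq f) 1)‖ :=
    fun U => Finset.prod_nonneg fun _ _ => norm_nonneg _
  refine integral_mono_of_nonneg (Eventually.of_forall fun U => ?_) ?_ (Eventually.of_forall fun U => ?_)
  · exact mul_nonneg (by split_ifs <;> norm_num) (h0 U)
  · simp_rw [weight_eq_norm_det]
    exact integrable_norm_det_diracMatrix mq _
  · show (if E U then (1 : ℝ) else 0) * _ ≤ _
    split_ifs
    · rw [one_mul]
    · rw [zero_mul]; exact h0 U

/-- A sure event has phase-quenched probability `1` whenever the normaliser is positive. -/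
theorem pqProb_eq_one_of_forall (β : ℝ) {Nf : ℕ} (mq : Fin Nf → ℝ) (E : GaugeConfig 4 N SU3 → Prop)
    {_dE : DecidablePred E} (hE : ∀ U, E U)
    (hZ : 0 < ∫ U, ∏ f, ‖fermionDet (wilsonDirac (fundamentalRep (Fin 3)) U (mq f) 1)‖
      ∂(wilsonMeasure (d := 4) (L := N) (fundamentalRep (Fin 3)) β)) :
    (∫ U, (if E U then (1 : ℝ) else 0) * ∏ f, ‖fermionDet (wilsonDirac (fundamentalRep (Fin 3)) U (mq f) 1)‖
        ∂(wilsonMeasure (d := 4) (L := N) (fundamentalRep (Fin 3)) β)) /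
      (∫ U, ∏ f, ‖fermionDet (wilsonDirac (fundamentalRep (Fin 3)) U (mq f) 1)‖
        ∂(wilsonMeasure (d := 4) (L := N) (fundamentalRep (Fin 3)) β)) = 1 := by
  have h : (fun U : GaugeConfig 4 N SU3 => (if E U then (1 : ℝ) else 0) *
      ∏ f, ‖fermionDet (wilsonDirac (fundamentalRep (Fin 3)) U (mq f) 1)‖) =
      fun U => ∏ f, ‖fermionDet (wilsonDirac (fundamentalRep (Fin 3)) U (mq f) 1)‖ :=
    funext fun U => by rw [if_pos (hE U), one_mul]
  rw [h, div_self hZ.ne']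

/-! ### The strip statistic of the stub at a large tolerance -/

/-- The kinetic edge of a box is at most `8`. -/
theorem edge_le_eight (s : Fin 4 → ℕ) : ∑ i, (1 - Real.cos (Real.pi / s i)) ≤ 8 := by
  calc ∑ i, (1 - Real.cos (Real.pi / s i)) ≤ ∑ _i : Fin 4, (2 : ℝ) :=
        Finset.sum_le_sum fun i _ => by linarith [Real.neg_one_le_cos (Real.pi / s i)]
    _ = 8 := by simp; norm_num

/-- **The strip statistic is large at a large tolerance, for EVERY ensemble.** The strip statistic
of the corner-`0` box `s` at tolerance `η` — VERBATIM the left-hand side of the windowed strip law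
(a⁺) of stub `stub_pinnedStripLaw` — is `≥ N_f / 4` as soon as the box contains an index, the
normaliser is positive and `|μ' + 4| + 4 < η` on the quarter-strips `[m_f, m_f + η/4] ⊆
[m_f, η − edge(s)]` (there every gauge field is `η`-near-kernel, `near_of_large_eta`, `P = 1`). -/
theorem le_stripStatistic (β : ℝ) {Nf : ℕ} (mq : Fin Nf → ℝ) (s : Fin 4 → ℕ)
    (p₁ : {p // wilsonBox (0 : TorusSite 4 N) s p}) {η : ℝ} (hη : 0 < η)
    (hbig : ∀ f, ∀ μ' ∈ Set.Icc (mq f) (mq f + η / 4), |μ' + 4| + 4 < η)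
    (htop : ∀ f, mq f + η / 4 ≤ η - ∑ i, (1 - Real.cos (Real.pi / s i)))
    (hZ : 0 < ∫ U, ∏ f, ‖fermionDet (wilsonDirac (fundamentalRep (Fin 3)) U (mq f) 1)‖
      ∂(wilsonMeasure (d := 4) (L := N) (fundamentalRep (Fin 3)) β)) :
    (Nf : ℝ) / 4 ≤
      η⁻¹ * ∑ f, (∫⁻ μ' in Set.Icc (mq f) (η - ∑ i, (1 - Real.cos (Real.pi / s i))),
        ENNReal.ofReal
          ((∫ U : GaugeConfig 4 N SU3, (if ((∃ v : {p // wilsonBox (0 : TorusSite 4 N) s p} → ℂ, v ≠ 0 ∧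
                ∑ p, ‖(wilsonCell U μ' 0 s).mulVec v p‖ ^ 2 < η ^ 2 * ∑ p, ‖v p‖ ^ 2) ∨
              ∃ c : Fin 4 → Bool, ∃ v : {p // wilsonBox (halfCorner s c : TorusSite 4 N) (halfSides s c) p} → ℂ,
                v ≠ 0 ∧ ∑ p, ‖(wilsonCell U μ' (halfCorner s c) (halfSides s c)).mulVec v p‖ ^ 2 <
                  η ^ 2 * ∑ p, ‖v p‖ ^ 2) then (1 : ℝ) else 0) *
                ∏ f, ‖fermionDet (wilsonDirac (fundamentalRep (Fin 3)) U (mq f) 1)‖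
              ∂(wilsonMeasure (d := 4) (L := N) (fundamentalRep (Fin 3)) β)) /
            (∫ U : GaugeConfig 4 N SU3, ∏ f, ‖fermionDet (wilsonDirac (fundamentalRep (Fin 3)) U (mq f) 1)‖
              ∂(wilsonMeasure (d := 4) (L := N) (fundamentalRep (Fin 3)) β)))).toReal := by
  -- the phase-quenched probability of the near-kernel event, as a function of the bare mass
  set P : ℝ → ℝ := fun μ' =>
    (∫ U : GaugeConfig 4 N SU3, (if ((∃ v : {p // wilsonBox (0 : TorusSite 4 N) s p} → ℂ, v ≠ 0 ∧
          ∑ p, ‖(wilsonCell U μ' 0 s).mulVec v p‖ ^ 2 < η ^ 2 * ∑ p, ‖v p‖ ^ 2) ∨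
        ∃ c : Fin 4 → Bool, ∃ v : {p // wilsonBox (halfCorner s c : TorusSite 4 N) (halfSides s c) p} → ℂ,
          v ≠ 0 ∧ ∑ p, ‖(wilsonCell U μ' (halfCorner s c) (halfSides s c)).mulVec v p‖ ^ 2 <
            η ^ 2 * ∑ p, ‖v p‖ ^ 2) then (1 : ℝ) else 0) *
          ∏ f, ‖fermionDet (wilsonDirac (fundamentalRep (Fin 3)) U (mq f) 1)‖
        ∂(wilsonMeasure (d := 4) (L := N) (fundamentalRep (Fin 3)) β)) /
      (∫ U : GaugeConfig 4 N SU3, ∏ f, ‖fermionDet (wilsonDirac (fundamentalRep (Fin 3)) U (mq f) 1)‖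
        ∂(wilsonMeasure (d := 4) (L := N) (fundamentalRep (Fin 3)) β)) with hPdef
  have hP1 : ∀ μ', P μ' ≤ 1 := fun μ' => pqProb_le_one β mq _ hZ
  have hP0 : ∀ f, ∀ μ' ∈ Set.Icc (mq f) (mq f + η / 4), P μ' = 1 := fun f μ' hμ' =>
    pqProb_eq_one_of_forall β mq _ (fun U => Or.inl (near_of_large_eta U μ' 0 s p₁ (hbig f μ' hμ'))) hZ
  -- per flavour: the quarter-strip alone carries Lebesgue mass `η/4`
  have hf : ∀ f, η / 4 ≤ (∫⁻ μ' in Set.Icc (mq f) (η - ∑ i, (1 - Real.cos (Real.pi / s i))),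
      ENNReal.ofReal (P μ')).toReal := by
    intro f
    have hsub : Set.Icc (mq f) (mq f + η / 4) ⊆ Set.Icc (mq f) (η - ∑ i, (1 - Real.cos (Real.pi / s i))) :=
      Set.Icc_subset_Icc le_rfl (htop f)
    have hfin : ∫⁻ μ' in Set.Icc (mq f) (η - ∑ i, (1 - Real.cos (Real.pi / s i))),
        ENNReal.ofReal (P μ') ≠ ∞ := by
      refine ne_top_of_le_ne_top ?_ (lintegral_mono fun μ' => ENNReal.ofReal_le_one.2 (hP1 μ'))
      rw [setLIntegral_one]
      exact measure_Icc_lt_top.ne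
    have hlow : ENNReal.ofReal (η / 4) ≤ ∫⁻ μ' in Set.Icc (mq f) (η - ∑ i, (1 - Real.cos (Real.pi / s i))),
        ENNReal.ofReal (P μ') := by
      calc ENNReal.ofReal (η / 4) = volume (Set.Icc (mq f) (mq f + η / 4)) := by
            rw [Real.volume_Icc]; congr 1; ring
        _ = ∫⁻ _μ' in Set.Icc (mq f) (mq f + η / 4), 1 := (setLIntegral_one _).symm
        _ = ∫⁻ μ' in Set.Icc (mq f) (mq f + η / 4), ENNReal.ofReal (P μ') := by
            refine setLIntegral_congr_fun measurableSet_Icc fun μ' hμ' => ?_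
            rw [hP0 f μ' hμ', ENNReal.ofReal_one]
        _ ≤ ∫⁻ μ' in Set.Icc (mq f) (η - ∑ i, (1 - Real.cos (Real.pi / s i))), ENNReal.ofReal (P μ') :=
            lintegral_mono_set hsub
    have h := ENNReal.toReal_mono hfin hlow
    rwa [ENNReal.toReal_ofReal (by positivity)] at h
  -- sum over flavours
  have hsum : (Nf : ℝ) * (η / 4) ≤ ∑ f : Fin Nf, (∫⁻ μ' in Set.Icc (mq f) (η - ∑ i, (1 - Real.cos (Real.pi / s i))),
      ENNReal.ofReal (P μ')).toReal := by
    have h := Finset.sum_le_sum fun f (_ : f ∈ Finset.univ) => hf f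
    rwa [Finset.sum_const, Finset.card_univ, Fintype.card_fin, nsmul_eq_mul] at h
  calc (Nf : ℝ) / 4 = η⁻¹ * ((Nf : ℝ) * (η / 4)) := by field_simp
    _ ≤ _ := mul_le_mul_of_nonneg_left hsum (inv_nonneg.2 hη.le)

/-! ### A valence mass off every free-field determinant root -/

/-- The bare mass enters additively: `D_W(U, μ, 1) = D_W(U, 0, 1) + μ·1` (the tree's
`wilsonDirac_mass_eq_add_scalar`, restated to keep the imports of this file small). -/
theorem wilsonDirac_mass_shift (U : GaugeConfig 4 N SU3) (μ : ℝ) :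
    wilsonDirac (fundamentalRep (Fin 3)) U μ 1 =
      wilsonDirac (fundamentalRep (Fin 3)) U 0 1 + Matrix.scalar _ (μ : ℂ) := by
  ext p q
  rw [Matrix.add_apply, Matrix.scalar_apply]
  simp only [wilsonDirac, Matrix.of_apply, Matrix.diagonal_apply]
  by_cases h : p = q
  · rw [if_pos h, if_pos h, if_pos h]; push_cast; ring
  · rw [if_neg h, if_neg h, if_neg h, add_zero]

/-- `det D_W(U, μ, 1)` is the value at `μ` of the (monic, hence non-zero) characteristic polynomial
of `−D_W(U, 0, 1)`. -/
theorem fermionDet_eq_eval_charpoly (U : GaugeConfig 4 N SU3) (μ : ℝ) :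
    fermionDet (wilsonDirac (fundamentalRep (Fin 3)) U μ 1) =
      (Matrix.charpoly (-wilsonDirac (fundamentalRep (Fin 3)) U 0 1)).eval (μ : ℂ) := by
  rw [Matrix.eval_charpoly, wilsonDirac_mass_shift U μ, sub_neg_eq_add, add_comm]

variable (N) in
/-- For a fixed gauge field (here the free field `U ≡ 1`) only finitely many real bare masses are
roots of the Wilson determinant. -/
theorem finite_detRoots :
    {μ : ℝ | fermionDet (wilsonDirac (fundamentalRep (Fin 3)) (1 : GaugeConfig 4 N SU3) μ 1) = 0}.Finite := by
  set P := Matrix.charpoly (-wilsonDirac (fundamentalRep (Fin 3)) (1 : GaugeConfig 4 N SU3) 0 1) with hP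
  have hfin : {z : ℂ | P.IsRoot z}.Finite := Polynomial.finite_setOf_isRoot (Matrix.charpoly_monic _).ne_zero
  have hset : {μ : ℝ | fermionDet (wilsonDirac (fundamentalRep (Fin 3)) (1 : GaugeConfig 4 N SU3) μ 1) = 0} =
      (fun μ : ℝ => (μ : ℂ)) ⁻¹' {z : ℂ | P.IsRoot z} := by
    ext μ
    simp only [Set.mem_setOf_eq, Set.mem_preimage, Polynomial.IsRoot.def, fermionDet_eq_eval_charpoly, hP]
  rw [hset]
  exact hfin.preimage Complex.ofReal_injective.injOn

/-- **A good valence mass.** Above any threshold `M₀` there is a renormalised mass `m₀` whose bare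
trajectory `m_crit(k) + a_k m₀ / Z_m(k)` avoids, for EVERY step `k` and EVERY odd torus, the finitely
many roots of the free-field Wilson determinant (a countable set of excluded values is
Lebesgue-null, so it cannot exhaust an interval). -/
theorem exists_good_mass {Nf : ℕ} (reg : QCDRegularisation Nf) (M₀ : ℝ) :
    ∃ m₀ : ℝ, M₀ < m₀ ∧ ∀ k S : ℕ,
      fermionDet (wilsonDirac (fundamentalRep (Fin 3)) (1 : GaugeConfig 4 (2 * S + 1) SU3)
        (reg.mcrit k + reg.a k * m₀ / reg.Zm k) 1) ≠ 0 := by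
  let Z : ℕ → Set ℝ := fun S =>
    {μ : ℝ | fermionDet (wilsonDirac (fundamentalRep (Fin 3)) (1 : GaugeConfig 4 (2 * S + 1) SU3) μ 1) = 0}
  let Bad : Set ℝ := ⋃ k : ℕ, ⋃ S : ℕ, (fun μ => (μ - reg.mcrit k) * reg.Zm k / reg.a k) '' Z S
  have hBad : Bad.Countable :=
    Set.countable_iUnion fun k => Set.countable_iUnion fun S =>
      ((finite_detRoots (2 * S + 1)).image _).countable
  obtain ⟨m₀, hm₀I, hm₀B⟩ : ∃ m₀ ∈ Set.Ioo M₀ (M₀ + 1), m₀ ∉ Bad := by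
    have hpos : volume (Set.Ioo M₀ (M₀ + 1) \ Bad) ≠ 0 := by
      rw [measure_sdiff_null (hBad.measure_zero volume), Real.volume_Ioo]; simp
    obtain ⟨m₀, hm₀⟩ := nonempty_of_measure_ne_zero hpos
    exact ⟨m₀, hm₀.1, hm₀.2⟩
  refine ⟨m₀, hm₀I.1, fun k S hdet => hm₀B ?_⟩
  refine Set.mem_iUnion.2 ⟨k, Set.mem_iUnion.2 ⟨S, ⟨reg.mcrit k + reg.a k * m₀ / reg.Zm k, hdet, ?_⟩⟩⟩
  have ha := (reg.a_pos k).ne'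
  have hZ := (reg.Zm_pos k).ne'
  field_simp; ring

/-- **Positivity of the phase-quenched normaliser** for masses off the free-field roots: the free
field has `det D ≠ 0`, and one such configuration suffices (tree
`integral_norm_det_diracMatrix_pos_of_exists`: continuity + the Wilson measure charges open sets). -/
theorem weight_integral_pos (β : ℝ) {Nf : ℕ} (mq : Fin Nf → ℝ)
    (h : ∀ f, fermionDet (wilsonDirac (fundamentalRep (Fin 3)) (1 : GaugeConfig 4 N SU3) (mq f) 1) ≠ 0) :
    0 < ∫ U, ∏ f, ‖fermionDet (wilsonDirac (fundamentalRep (Fin 3)) U (mq f) 1)‖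
      ∂(wilsonMeasure (d := 4) (L := N) (fundamentalRep (Fin 3)) β) := by
  have h1 : (diracMatrix (1 : GaugeConfig 4 N SU3) mq).det ≠ 0 := by
    rw [det_diracMatrix]; exact Finset.prod_ne_zero_iff.2 fun f _ => h f
  simpa only [← weight_eq_norm_det] using integral_norm_det_diracMatrix_pos_of_exists β mq ⟨1, h1⟩

/-! ### Small geometric facts: an admissible volume, an index inside the box -/

/-- A torus side serving the physical size `R` at spacing `a > 0` and exceeding `b₀`. -/
theorem exists_side (a R : ℝ) (ha : 0 < a) (b₀ : ℕ) :
    ∃ S : ℕ, R ≤ a * (2 * S + 1) ∧ b₀ ≤ 2 * S + 1 ∧ 1 ≤ S := by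
  refine ⟨⌈R / a⌉₊ + b₀ + 1, ?_, by omega, by omega⟩
  have h1 : R ≤ a * ⌈R / a⌉₊ := by
    have := Nat.le_ceil (R / a); rw [div_le_iff₀ ha] at this; linarith
  have h2 : (⌈R / a⌉₊ : ℝ) ≤ 2 * ((⌈R / a⌉₊ + b₀ + 1 : ℕ) : ℝ) + 1 := by
    push_cast
    linarith [Nat.cast_nonneg (α := ℝ) b₀, Nat.cast_nonneg (α := ℝ) ⌈R / a⌉₊]
  nlinarith

omit [NeZero N] in
/-- On a torus of side `> 1`, the index at site `(1,1,1,1)`, colour `0`, spin `0` lies in every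
corner-`0` box with sides `≥ 2`. -/
theorem one_mem_wilsonBox (hN : 1 < N) (s : Fin 4 → ℕ) (hs : ∀ i, 2 ≤ s i) :
    wilsonBox (0 : TorusSite 4 N) s ((fun _ => (1 : ZMod N)), (0 : Fin 3), (0 : Fin 4)) := by
  haveI : Fact (1 < N) := ⟨hN⟩
  intro i
  simp only [Pi.zero_apply, sub_zero, ZMod.val_one]
  exact ⟨Nat.one_pos, hs i⟩

/-! ### The tolerance-robust strip law is false, for every regularisation -/

/-- **The tolerance-robust strip law is false — for EVERY regularisation.** Refuted: VERBATIM the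
windowed strip law (a⁺) (conjunct 1 of stub `stub_pinnedStripLaw`, line `mass-wegner-cell-index`,
crux `NegativeCellsDilute`) with the single change `∃ η : ℝ, 0 < η ∧` ↦ `∀ η : ℝ, 0 < η →`, the
conjuncts playing no role (`HasMassScaling`, `HasAsymptoticScaling`, the pin (b)) dropped — every
variant carrying them, e.g. the stub with that one token changed, is refuted a fortiori. Proof: for
the witness `reg, M₀, b₀, ℓ` take a good valence mass `m₀ > M₀` (`exists_good_mass`), the produced
`R`, `ε = 1/8`, a step `k` of the eventual range with `a_k b₀ ≤ ℓ`, an odd torus of side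
`2S + 1 ≥ b₀`, `η = 2|m₀(k)| + 20`, the scale-`0` box `s ≡ b₀`: its strip statistic is `≥ 1/2`
(`le_stripStatistic`, `weight_integral_pos`) against `≤ δ₀ ≤ Σ_j δ_j ≤ 1/8`. -/
theorem not_stripLaw_forall_eta :
    ¬ (∀ Nf : ℕ, (Nf = 2 ∨ Nf = 3) → ∃ reg : QCDRegularisation Nf, ∃ M₀ : ℝ, 0 ≤ M₀ ∧ ∃ b₀ : ℕ, 2 ≤ b₀ ∧
      ∃ ℓ : ℝ, 0 < ℓ ∧ ∀ m : Fin Nf → ℝ, (∀ f, M₀ < m f) → ∃ R : ℝ, 0 < R ∧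
      ∀ ε : ℝ, 0 < ε → ∀ᶠ k : ℕ in Filter.atTop, ∀ S : ℕ, R ≤ reg.a k * (2 * S + 1) →
        ∀ η : ℝ, 0 < η → ∃ δ : ℕ → ℝ, (∀ j, 0 ≤ δ j) ∧
          ∑ j ∈ Finset.range (Nat.log 2 (⌊ℓ / reg.a k⌋₊ / b₀) + 1), δ j ≤ ε ∧
          ∀ j < Nat.log 2 (⌊ℓ / reg.a k⌋₊ / b₀) + 1, ∀ s : Fin 4 → ℕ,
            (∀ i, b₀ * 2 ^ j ≤ s i ∧ s i < b₀ * 2 ^ (j + 2) ∧ s i ≤ 2 * S + 1 ∧ (s i : ℝ) * reg.a k ≤ ℓ) →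
            η⁻¹ * ∑ f, (∫⁻ μ' in Set.Icc (reg.mcrit k + reg.a k * m f / reg.Zm k) (η - ∑ i, (1 - Real.cos (Real.pi / s i))),
            ENNReal.ofReal
              ((∫ U : GaugeConfig 4 (2 * S + 1) SU3, (if ((∃ v : {p // wilsonBox (0 : TorusSite 4 (2 * S + 1)) s p} → ℂ, v ≠ 0 ∧
                    ∑ p, ‖(wilsonCell U μ' 0 s).mulVec v p‖ ^ 2 < η ^ 2 * ∑ p, ‖v p‖ ^ 2) ∨
                  ∃ c : Fin 4 → Bool, ∃ v : {p // wilsonBox (halfCorner s c : TorusSite 4 (2 * S + 1)) (halfSides s c) p} → ℂ,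
                    v ≠ 0 ∧ ∑ p, ‖(wilsonCell U μ' (halfCorner s c) (halfSides s c)).mulVec v p‖ ^ 2 <
                      η ^ 2 * ∑ p, ‖v p‖ ^ 2) then (1 : ℝ) else 0) *
                    ∏ f, ‖fermionDet (wilsonDirac (fundamentalRep (Fin 3)) U (reg.mcrit k + reg.a k * m f / reg.Zm k) 1)‖
                  ∂(wilsonMeasure (d := 4) (L := (2 * S + 1)) (fundamentalRep (Fin 3)) (reg.β k))) /
                (∫ U : GaugeConfig 4 (2 * S + 1) SU3, ∏ f, ‖fermionDet (wilsonDirac (fundamentalRep (Fin 3)) U (reg.mcrit k + reg.a k * m f / reg.Zm k) 1)‖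
                  ∂(wilsonMeasure (d := 4) (L := (2 * S + 1)) (fundamentalRep (Fin 3)) (reg.β k))))).toReal ≤ δ j) := by
  intro h
  obtain ⟨reg, M₀, -, b₀, hb₀, ℓ, hℓ, hm⟩ := h 2 (Or.inl rfl)
  -- a good valence mass and the data it produces
  obtain ⟨m₀, hm₀, hgood⟩ := exists_good_mass reg M₀
  obtain ⟨R, -, hA⟩ := hm (fun _ => m₀) (fun _ => hm₀)
  have h1 := hA (1 / 8) (by norm_num)
  have h2 : ∀ᶠ k : ℕ in Filter.atTop, reg.a k * b₀ ≤ ℓ := by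
    have ht : Tendsto (fun k => reg.a k * b₀) atTop (𝓝 (0 * b₀)) := reg.tendsto_a.mul_const _
    rw [zero_mul] at ht
    exact (ht.eventually (Iio_mem_nhds hℓ)).mono fun k hk => le_of_lt hk
  obtain ⟨k, hk, hkℓ⟩ := (h1.and h2).exists
  -- an admissible volume, the tolerance
  obtain ⟨S, hSR, hSb, hS1⟩ := exists_side (reg.a k) R (reg.a_pos k) b₀
  set μk : ℝ := reg.mcrit k + reg.a k * m₀ / reg.Zm k with hμk
  set η : ℝ := 2 * |μk| + 20 with hηdef
  have hηpos : 0 < η := by positivity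
  obtain ⟨δ, hδ0, hδsum, hbox⟩ := hk S hSR η hηpos
  -- the scale-0 window box `s ≡ b₀`
  have hJ : 0 < Nat.log 2 (⌊ℓ / reg.a k⌋₊ / b₀) + 1 := Nat.succ_pos _
  have hδle : δ 0 ≤ 1 / 8 :=
    le_trans (Finset.single_le_sum (fun j _ => hδ0 j) (Finset.mem_range.2 hJ)) hδsum
  have hwin : ∀ i : Fin 4, b₀ * 2 ^ 0 ≤ (fun _ : Fin 4 => b₀) i ∧ (fun _ : Fin 4 => b₀) i < b₀ * 2 ^ (0 + 2) ∧
      (fun _ : Fin 4 => b₀) i ≤ 2 * S + 1 ∧ (((fun _ : Fin 4 => b₀) i : ℕ) : ℝ) * reg.a k ≤ ℓ := by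
    intro i
    refine ⟨by simp, by simp; omega, hSb, ?_⟩
    simp only
    linarith [mul_comm (reg.a k) (b₀ : ℝ)]
  have hstat := hbox 0 hJ (fun _ => b₀) hwin
  -- the lower bound
  set mq : Fin 2 → ℝ := fun _ => μk with hmq
  have hN1 : 1 < 2 * S + 1 := by omega
  let p₁ : {p // wilsonBox (0 : TorusSite 4 (2 * S + 1)) (fun _ : Fin 4 => b₀) p} :=
    ⟨_, one_mem_wilsonBox hN1 (fun _ => b₀) fun _ => hb₀⟩
  have hlo : -|μk| ≤ μk := neg_abs_le μk
  have hhi : μk ≤ |μk| := le_abs_self μk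
  have hbig : ∀ f, ∀ μ' ∈ Set.Icc (mq f) (mq f + η / 4), |μ' + 4| + 4 < η := by
    intro f μ' hμ'
    simp only [hmq, Set.mem_Icc] at hμ'
    have habs : |μ' + 4| ≤ |μk| + η / 4 + 4 := by
      rw [abs_le]; constructor <;> linarith
    rw [hηdef] at habs ⊢
    linarith
  have htop : ∀ f, mq f + η / 4 ≤ η - ∑ i, (1 - Real.cos (Real.pi / (fun _ : Fin 4 => b₀) i)) := by
    intro f
    have he := edge_le_eight (fun _ : Fin 4 => b₀)
    simp only [hmq]
    rw [hηdef]
    linarith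
  have hZ : 0 < ∫ U, ∏ f, ‖fermionDet (wilsonDirac (fundamentalRep (Fin 3)) U (mq f) 1)‖
      ∂(wilsonMeasure (d := 4) (L := 2 * S + 1) (fundamentalRep (Fin 3)) (reg.β k)) :=
    weight_integral_pos (reg.β k) mq fun _ => hgood k S
  have hlow := le_stripStatistic (N := 2 * S + 1) (reg.β k) mq (fun _ => b₀) p₁ hηpos hbig htop hZ
  have key : (1 / 8 : ℝ) < _ := lt_of_lt_of_le (by norm_num) hlow
  exact lt_irrefl _ (key.trans_le (hstat.trans hδle))

end Summit.QuantumFields.QCD.Theorems.NegativeCellsDiluteStripLawForallEtaFalse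

end
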